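import Mathlib
import HarnessLib
import Literature.MathematicalPhysics.QuantumLattice.HeisenbergOrderNeelRiemann3
import Summits.HubbardSuperconductivity.HubbardSuperconductivity.Theorems.KLProgrammeFreeBandPolarOctant
import Summits.HubbardSuperconductivity.HubbardSuperconductivity.Theorems.KLProgrammePerturbedFermiCurveWindowJetsDefs

/-!
# Route `KLProgramme` — ENGINE crux `KLRegimeEngineV17F2` (stmt-HubbardSuperconductivity-20437), row (C) / the c4a-1 (A) lane:
# the four ORDER-ZERO entries of the free-band polar-jet table `klwjTableB` (window `[-1.1, -0.1]`) are THEOREMS; `KlwjCertB` reduces to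
# its twelve derivative entries (cell gate-hubbard-kl, seat p1b g19 = 20437 registrant lineage; 0 kit)

Twin of `…PerturbedFermiCurveWindowJetsOrderZero` (table A) for the table of record on the band range `[-1.1, -0.1]` of `frame_sizes_of_frameOK`,
`KlwjCertB := FreeBandPolarJets (-1.1) (-0.1) klwjTableB` — the named kit-certified hypothesis (j284449) carried by the c4a-1 arc/loop-circle files
(`…C4aLoopCircleCanonical*`, `…C4aTwoArcs*`, `…C4aGenericArcUniformFar*`, …).  From the octant analysis of `…FreeBandPolarOctant`:
`umin = 1.826 ≤ u_μ(θ)` (true minimum `√2·arccos(0.275) = 1.82753…`) · `u_μ(θ) ≤ umax = 2.826` (true maximum `arccos(-0.95) = 2.82403…`) ·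
`Dtmin = 0.6225 ≤ ∂_tF(θ, u_μ(θ))` (true minimum `√0.39 = 0.62450…`) · `|J_μ(θ)| ≤ G0 = 4.538` (true maximum `4.5221…`), every `μ ∈ [-1.1, -0.1]`,
every angle.
* §4 the window numerics: `F(0, 2.826) ≥ -0.1`, `F(π/4, 1.826) ≤ -1.1`, `(2 sin u_μ(0))² = -μ(4+μ) ≥ 0.6244²`, `2.826/0.6244 ≤ 4.538`; `klwjB_orderZero`.
* §5 **`klwjCertB_orderZero`** and the REDUCTION **`klwjCertB_of_jets`**: `KlwjCertB` follows from its twelve DERIVATIVE entries alone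
  (a consumer may feed `hT := klwjCertB_of_jets hJ`); no consumer, closer, registered row or skeleton is touched.
Honest framing: elementary facts about the FREE dispersion; the twelve derivative entries of `klwjTableB` remain a kit-certified hypothesis;
nothing here asserts row (C), (A), any stub of 20437, K3, U₀, the window, a margin or superconductivity in the Hubbard model.
References: BGM 2006 §2.4 Lemma 2.1 (2.40) [cite: BenfattoGiulianiMastropietro2006].
-/

noncomputable section

namespace Summit.HubbardSuperconductivity.HubbardSuperconductivity.Theorems.PerturbedFermiCurve

set_option linter.dupNamespace false -- summit = problem name (single-conjunct summit), D-0017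

open Real Set Literature.MathematicalPhysics.QuantumLattice

/-! ## §4 The four order-zero entries of `klwjTableB` on `[-1.1, -0.1]` -/

/-- `F(0, 2.826) ≥ -0.1`: `cos 2.826 = -cos(π - 2.826) ≤ -(1 - (π - 2.826)²/2) ≤ -0.9502`. -/
theorem rayDispersion_zero_2826_ge : (-0.1 : ℝ) ≤ rayDispersion (0, 2.826) := by
  rw [rayDispersion_eq]
  simp only [Real.cos_zero, Real.sin_zero, mul_one, mul_zero]
  have hπ1 := Real.pi_gt_d6
  have hπ2 := Real.pi_lt_d6
  have hx0 : 0 ≤ π - 2.826 := by linarith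
  have hx1 : π - 2.826 ≤ 0.315593 := by linarith
  have hcos : Real.cos 2.826 = -Real.cos (π - 2.826) := by rw [Real.cos_pi_sub]; ring
  have hc := Real.one_sub_sq_div_two_le_cos (x := π - 2.826)
  have hsq : (π - 2.826) ^ 2 ≤ 0.315593 ^ 2 := pow_le_pow_left₀ hx0 hx1 2
  rw [hcos]
  nlinarith [hc, hsq]

/-- `F(π/4, 1.826) ≤ -1.1`: `cos(1.826/√2) ≥ T₆(1.826/√2) ≥ 0.2758` (sixth-order Taylor minorant, even powers only). -/
theorem rayDispersion_pi_div_four_1826_le : rayDispersion (π / 4, 1.826) ≤ (-1.1 : ℝ) := by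
  rw [rayDispersion_eq]
  simp only [Real.cos_pi_div_four, Real.sin_pi_div_four]
  set y := (1.826 : ℝ) * (Real.sqrt 2 / 2) with hy
  have hy2 : y ^ 2 = 1.826 ^ 2 / 2 := by
    rw [hy, mul_pow, div_pow, Real.sq_sqrt (by norm_num : (0 : ℝ) ≤ 2)]; ring
  have hy0 : 0 ≤ y := by positivity
  have h := KLSNumerics.taylor_six_le_cos hy0
  have h4 : y ^ 4 = (y ^ 2) ^ 2 := by ring
  have h6 : y ^ 6 = (y ^ 2) ^ 3 := by ring
  rw [h4, h6, hy2] at h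
  norm_num at h
  linarith

section Window

variable {μ : ℝ} (hμ : μ ∈ Icc (-1.1 : ℝ) (-0.1))
include hμ

/-- On the window: `u_μ(0) ≤ 2.826`. -/
theorem bandFermiRadius_zero_le_2826 : bandFermiRadius μ 0 ≤ 2.826 := by
  have hμ₁ : -4 < μ := by linarith [hμ.1]
  have hμ₂ : μ < 0 := by linarith [hμ.2]
  have h1 : ‖dir (0 : ℝ)‖ = 1 := by
    rw [norm_dir, Real.cos_zero, Real.sin_zero, abs_one, abs_zero, max_eq_left zero_le_one]
  refine bandFermiRadius_le_of_le_rayDispersion hμ₁ hμ₂ (by norm_num) ?_ (hμ.2.trans rayDispersion_zero_2826_ge)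
  rw [h1, mul_one]; linarith [Real.pi_gt_three]

/-- On the window: `1.826 ≤ u_μ(π/4)`. -/
theorem le_bandFermiRadius_pi_div_four_1826 : 1.826 ≤ bandFermiRadius μ (π / 4) := by
  have hμ₁ : -4 < μ := by linarith [hμ.1]
  have hμ₂ : μ < 0 := by linarith [hμ.2]
  have h1 : ‖dir (π / 4)‖ = Real.sqrt 2 / 2 := by
    rw [norm_dir_of_mem_octant ⟨by positivity, le_rfl⟩, Real.cos_pi_div_four]
  refine le_bandFermiRadius_of_rayDispersion_le hμ₁ hμ₂ (by norm_num) ?_ (rayDispersion_pi_div_four_1826_le.trans hμ.1)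
  rw [h1]
  have hs : Real.sqrt 2 ≤ 2 := by
    rw [show (2 : ℝ) = Real.sqrt (2 ^ 2) by rw [Real.sqrt_sq (by norm_num : (0:ℝ) ≤ 2)]]
    exact Real.sqrt_le_sqrt (by norm_num)
  nlinarith [Real.pi_gt_three, Real.sqrt_nonneg 2]

/-- On the window: `0.6244 ≤ 2 sin u_μ(0)` (`(2 sin u_μ(0))² = -μ(4+μ) ≥ 0.39`). -/
theorem two_sin_bandFermiRadius_zero_ge_B : 0.6244 ≤ 2 * Real.sin (bandFermiRadius μ 0) := by
  have hμ₁ : -4 < μ := by linarith [hμ.1]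
  have hμ₂ : μ < 0 := by linarith [hμ.2]
  have hsq := sq_two_sin_bandFermiRadius_zero hμ₁ hμ₂
  have hnn : 0 ≤ 2 * Real.sin (bandFermiRadius μ 0) := by
    have := sin_bandFermiRadius_zero_nonneg hμ₁ hμ₂; positivity
  have hval : (0.6244 : ℝ) ^ 2 ≤ (2 * Real.sin (bandFermiRadius μ 0)) ^ 2 := by
    rw [hsq]
    have h1 : 0 ≤ -0.1 - μ := by linarith [hμ.2]
    have h2 : 0 ≤ 4 + μ + (-0.1) := by linarith [hμ.1]
    nlinarith [mul_nonneg h1 h2]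
  exact (pow_le_pow_iff_left₀ (by norm_num) hnn two_ne_zero).1 hval

/-- **ORDER ZERO, first octant**: the four order-zero entries of `klwjTableB` at `θ ∈ [0, π/4]`. -/
theorem klwjB_orderZero_octant {θ : ℝ} (hθ : θ ∈ Icc 0 (π / 4)) :
    1.826 ≤ bandFermiRadius μ θ ∧ bandFermiRadius μ θ ≤ 2.826 ∧
      0.6225 ≤ rayDispersionDt θ (bandFermiRadius μ θ) ∧ |freePolarJac μ θ| ≤ 4.538 := by
  have hμ₁ : -4 < μ := by linarith [hμ.1]
  have hμ₂ : μ < 0 := by linarith [hμ.2]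
  have hfloor := two_sin_bandFermiRadius_zero_ge_B hμ
  refine ⟨(le_bandFermiRadius_pi_div_four_1826 hμ).trans (bandFermiRadius_pi_div_four_le hμ₁ hμ₂ hθ),
    (bandFermiRadius_le_zero hμ₁ hμ₂ hθ).trans (bandFermiRadius_zero_le_2826 hμ), ?_, ?_⟩
  · linarith [two_sin_le_rayDispersionDt hμ₁ hμ₂ hθ]
  · have hJ0 : 0 ≤ freePolarJac μ θ :=
      div_nonneg (bandFermiRadius_pos hμ₁ hμ₂ θ).le (rayDispersionDt_bandFermiRadius_pos hμ₁ hμ₂ θ).le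
    rw [abs_of_nonneg hJ0]
    have h := bandFermiRadius_div_le hμ₁ hμ₂ hθ (bandFermiRadius_zero_le_2826 hμ) (by norm_num : (0 : ℝ) < 0.6244) hfloor
    unfold freePolarJac
    have : (2.826 : ℝ) / 0.6244 ≤ 4.538 := by norm_num
    linarith

/-- **ORDER ZERO, every angle** (`D₄` reduction to the first octant). -/
theorem klwjB_orderZero (θ : ℝ) :
    1.826 ≤ bandFermiRadius μ θ ∧ bandFermiRadius μ θ ≤ 2.826 ∧
      0.6225 ≤ rayDispersionDt θ (bandFermiRadius μ θ) ∧ |freePolarJac μ θ| ≤ 4.538 := by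
  have hμ₁ : -4 < μ := by linarith [hμ.1]
  have hμ₂ : μ < 0 := by linarith [hμ.2]
  obtain ⟨θ', hθ', hF, hD, hn⟩ := exists_octant_angle θ
  have hu : bandFermiRadius μ θ' = bandFermiRadius μ θ := bandFermiRadius_eq_of_forall_eq hμ₁ hμ₂ hF hn
  have h := klwjB_orderZero_octant hμ hθ'
  have hJ : freePolarJac μ θ' = freePolarJac μ θ := by unfold freePolarJac; rw [hu, hD]
  rw [hu, hD, hJ] at h
  exact h

end Window

/-! ## §5 The reduction of `KlwjCertB` to its twelve derivative entries -/

/-- **`KlwjCertB`'s order-zero conjuncts are THEOREMS**: `umin ≤ u ≤ umax`, `Dtmin ≤ ∂_tF` and `|J| ≤ G0` of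
`FreeBandPolarJets (-1.1) (-0.1) klwjTableB`. -/
theorem klwjCertB_orderZero {μ : ℝ} (hμ : μ ∈ Icc (-1.1 : ℝ) (-0.1)) (θ : ℝ) :
    (klwjTableB.umin ≤ bandFermiRadius μ θ ∧ bandFermiRadius μ θ ≤ klwjTableB.umax ∧
      klwjTableB.Dtmin ≤ rayDispersionDt θ (bandFermiRadius μ θ)) ∧ |freePolarJac μ θ| ≤ klwjTableB.G0 := by
  obtain ⟨h1, h2, h3, h4⟩ := klwjB_orderZero hμ θ
  exact ⟨⟨h1, h2, h3⟩, h4⟩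

/-- **REDUCTION.**  `KlwjCertB` follows from its twelve DERIVATIVE entries alone (radius tower `R1…R4`, slope tower `D1…D4`,
Jacobian tower `G1…G4`); the four order-zero entries are supplied by `klwjCertB_orderZero`.  Consumers may replace the
hypothesis `hT : KlwjCertB` by `klwjCertB_of_jets hJ`. -/
theorem klwjCertB_of_jets
    (hJ : ∀ μ ∈ Icc (-1.1 : ℝ) (-0.1), ∀ θ : ℝ,
      (|deriv (bandFermiRadius μ) θ| ≤ klwjTableB.R1 ∧ |deriv (deriv (bandFermiRadius μ)) θ| ≤ klwjTableB.R2 ∧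
        |deriv (deriv (deriv (bandFermiRadius μ))) θ| ≤ klwjTableB.R3 ∧
        |deriv (deriv (deriv (deriv (bandFermiRadius μ)))) θ| ≤ klwjTableB.R4) ∧
      (|deriv (freeRadialSlope μ) θ| ≤ klwjTableB.D1 ∧ |deriv (deriv (freeRadialSlope μ)) θ| ≤ klwjTableB.D2 ∧
        |deriv (deriv (deriv (freeRadialSlope μ))) θ| ≤ klwjTableB.D3 ∧
        |deriv (deriv (deriv (deriv (freeRadialSlope μ)))) θ| ≤ klwjTableB.D4) ∧
      (|deriv (freePolarJac μ) θ| ≤ klwjTableB.G1 ∧ |deriv (deriv (freePolarJac μ)) θ| ≤ klwjTableB.G2 ∧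
        |deriv (deriv (deriv (freePolarJac μ))) θ| ≤ klwjTableB.G3 ∧
        |deriv (deriv (deriv (deriv (freePolarJac μ)))) θ| ≤ klwjTableB.G4)) :
    KlwjCertB := by
  intro μ hμ θ
  obtain ⟨h0, hG0⟩ := klwjCertB_orderZero hμ θ
  obtain ⟨hR, hD, hG⟩ := hJ μ hμ θ
  exact ⟨h0, hR, hD, ⟨hG0, hG⟩⟩

end Summit.HubbardSuperconductivity.HubbardSuperconductivity.Theorems.PerturbedFermiCurve
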